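import Literature.NumberTheory.EllipticCurves.TateModuleGaloisTransportProofs
import Literature.NumberTheory.EllipticCurves.TateModuleBaseChange
import HarnessLib

/-!
# `T_p(E^{(d)}) ≅ T_p(E) ⊗ χ_d` on the INTEGRAL Tate modules, with continuity (transport proofs)

`Proofs` file (theorems only, no definitions, no named facts) in topic `NumberTheory/EllipticCurves`; integral
companion of `TateModuleGaloisTransportProofs.lean`, which produces the RATIONAL `V_ℓ(E^{(d)}) ≃ V_ℓ(E) ⊗ χ_d`
(`WeierstrassCurve.exists_rationalTateModule_equiv_quadraticTwist`) from the point-level isomorphism with signs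
`WeierstrassCurve.exists_addEquiv_geomPoints_quadraticTwist_sign` (`E^{(d)}(K̄) ≃+ E(K̄)`, `f(σP) = ±σf(P)` according
to `σ√d = ±√d`; Silverman, *AEC*, X.5 Cor. 5.4, X.2 Prop. 2.4).  Seat `bsd-2adic-conv-1` GEN 30 (cell `pub/bsd-2adic`):
the Iwasawa-cohomology Shapiro maps of Kato's `𝐇¹_Γ(T_pW)` (files `Kato2004/IwasawaCohomologyNumberField*.lean`)
carry the INTEGRAL, TOPOLOGICAL Tate module `T_p = lim← E[pⁿ]`, so the twisted restriction / corestriction for the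
quadratic twist `A = E^{(d_K)}` of a Greenberg pair `(E, K)` needs the integral statement with continuity:

* `Literature.NumberTheory.EllipticCurves.exists_tateModule_equiv_of_addEquiv` — **`T_p` is a functor, integrally and
  continuously**: an additive isomorphism `e : A ≃+ B` of discrete modules, equivariant along `r : Γ' → Γ` up to signs
  `s : Γ' → ℤˣ` (`e (r γ • a) = s γ • γ • e a`), induces a `ℤ_p`-linear isomorphism `E = T_p e : T_p A ≃ T_p B`,
  continuous in both directions for the profinite topologies, computed coordinatewise (`(E a)_n = e a_n`), with
  `E (r γ • x) = s γ • γ • E x` (Silverman, *AEC*, III.§7; Serre 1968, I §1.1–1.2);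
* `WeierstrassCurve.exists_tateModule_equiv_quadraticTwist_sign` — **`T_p(E^{(d)}) ≃ T_p(E)`**, continuous, with
  `E(σx) = σE(x)` if `σ√d = √d` and `E(σx) = −σE(x)` if `σ√d = −√d` (`2 ≠ 0`, `d ≠ 0`);
* `WeierstrassCurve.exists_tateModule_equiv_of_smul_eq_quadraticTwist` — the same for any model `A` of the twist,
  `C • A = E^{(d)}` for a change of variables `C` over `K` (the changes of variables act `Γ_K`-equivariantly on `K̄`-points,
  `VariableChange.pointEquivBaseChange_map_algEquiv`) — the shape in which the cell's habitat (β) presents the twist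
  (`C • A = W.quadraticTwist (discr K)`).

All axioms `propext`, `Classical.choice`, `Quot.sound`.

## References

* J. H. Silverman, *The Arithmetic of Elliptic Curves*, 2nd ed. (2009), III.§7, X.2 Prop. 2.4, X.5 Cor. 5.4.
  [SilvermanAEC2009]
* J.-P. Serre, *Abelian ℓ-adic representations and elliptic curves* (1968), I §1.1–1.2. [SerreAbelianLadic1968]
-/

noncomputable section

open scoped Classical

open Field

universe u

namespace Literature.NumberTheory.EllipticCurves

/-! ## Functoriality of `T_p` on (twisted-)equivariant additive isomorphisms, integrally and continuously -/

section Functor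

variable {Γ : Type*} {Γ' : Type*} [Group Γ] [Group Γ'] {A : Type u} {B : Type u}
  [AddCommGroup A] [AddCommGroup B] [DistribMulAction Γ A] [DistribMulAction Γ' B]
  [TopologicalSpace A] [DiscreteTopology A] [TopologicalSpace B] [DiscreteTopology B]
  (p : ℕ) [Fact p.Prime]

/-- **`T_p` is a functor: transport of the Galois action along an additive isomorphism, INTEGRALLY and CONTINUOUSLY.**
Let `e : A ≃+ B` be an additive isomorphism of discrete modules, `r : Γ' → Γ` a group homomorphism and `s : Γ' → ℤˣ` signs
with `e (r γ • a) = s γ • (γ • e a)`.  Then `E = T_p e : T_p A ≃ T_p B` is a `ℤ_p`-linear isomorphism (inverse `T_p e⁻¹`),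
continuous in both directions, coordinatewise `(E a)_n = e (a_n)`, with `E (r γ • x) = s γ • (γ • E x)`.
Silverman, *AEC*, III.§7; Serre (1968), I §1.1–1.2. [cite: SilvermanAEC2009, III.§7] -/
theorem exists_tateModule_equiv_of_addEquiv (r : Γ' →* Γ) (s : Γ' → ℤˣ) (e : A ≃+ B)
    (he : ∀ (γ : Γ') (a : A), e (r γ • a) = (s γ : ℤ) • (γ • e a)) :
    ∃ E : TateModule A p ≃ₗ[ℤ_[p]] TateModule B p,
      Continuous E ∧ Continuous E.symm ∧
      (∀ (a : TateModule A p) (n : ℕ), TateModule.proj p n (E a) = e (TateModule.proj p n a)) ∧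
      ∀ (γ : Γ') (x : TateModule A p), E (r γ • x) = (s γ : ℤ) • (γ • E x) := by
  -- `T_p e` and its inverse
  set T : TateModule A p →ₗ[ℤ_[p]] TateModule B p := TateModule.map p e.toAddMonoidHom with hT
  set T' : TateModule B p →ₗ[ℤ_[p]] TateModule A p := TateModule.map p e.symm.toAddMonoidHom with hT'
  have h1 : T'.comp T = LinearMap.id := by
    rw [hT, hT', ← TateModule.map_comp, ← TateModule.map_id (p := p) (A := A)]
    congr 1
    ext a
    exact e.symm_apply_apply a
  have h2 : T.comp T' = LinearMap.id := by
    rw [hT, hT', ← TateModule.map_comp, ← TateModule.map_id (p := p) (A := B)]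
    congr 1
    ext b
    exact e.apply_symm_apply b
  let TE : TateModule A p ≃ₗ[ℤ_[p]] TateModule B p := LinearEquiv.ofLinear T T' h2 h1
  refine ⟨TE, ?_, ?_, fun a n ↦ rfl, fun γ x ↦ ?_⟩
  · exact TateModule.continuous_map continuous_of_discreteTopology
  · exact TateModule.continuous_map continuous_of_discreteTopology
  · refine TateModule.ext fun n ↦ ?_
    change TateModule.proj p n (T (r γ • x)) = TateModule.proj p n ((s γ : ℤ) • (γ • T x))
    rw [hT, TateModule.proj_map, TateModule.proj_smul_of_distribMulAction, map_zsmul,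
      TateModule.proj_smul_of_distribMulAction, TateModule.proj_map]
    exact he γ _

end Functor

end Literature.NumberTheory.EllipticCurves

namespace WeierstrassCurve

open Literature.NumberTheory.EllipticCurves Literature.NumberTheory.GaloisRepresentations

/-! ## `T_p(E^{(d)}) ≅ T_p(E) ⊗ χ_d` -/

section Twist

variable {K : Type u} [Field K] [NeZero (2 : K)]

/-- In characteristic `≠ 2`, `σ√d = -√d` excludes `σ√d = √d` (`d ≠ 0`, so `2√d ≠ 0`). [folklore] -/
private theorem not_smul_geomSqrt_eq_of_eq_neg {d : K} (hd : d ≠ 0) (σ : absoluteGaloisGroup K)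
    (hσ : σ • geomSqrt d = -geomSqrt d) : ¬ σ • geomSqrt d = geomSqrt d := fun h' ↦ by
  have h2K : (2 : AlgebraicClosure K) ≠ 0 := by
    rw [← map_ofNat (algebraMap K (AlgebraicClosure K)) 2]
    exact (map_ne_zero (algebraMap K (AlgebraicClosure K))).mpr (NeZero.ne 2)
  have h0 : (2 : AlgebraicClosure K) * geomSqrt d = 0 := by
    rw [two_mul]
    nth_rw 1 [← h']
    rw [hσ, neg_add_cancel]
  exact mul_ne_zero h2K (geomSqrt_ne_zero hd) h0

/-- **`T_p(E^{(d)}) ≃ T_p(E)`, continuous, with `E(σx) = ±σE(x)` according to `σ√d = ±√d`** (`2 ≠ 0`, `d ≠ 0`): the integral,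
topological form of the tree's `exists_rationalTateModule_equiv_quadraticTwist`, from the point-level
`exists_addEquiv_geomPoints_quadraticTwist_sign` by `exists_tateModule_equiv_of_addEquiv`. Silverman, *AEC*, X.5 Cor. 5.4 with III.§7.
[cite: SilvermanAEC2009, X.5 Cor. 5.4] -/
theorem exists_tateModule_equiv_quadraticTwist_sign (W : WeierstrassCurve K) {d : K} (hd : d ≠ 0)
    (p : ℕ) [Fact p.Prime] :
    ∃ E : (W.quadraticTwist d).tateModule p ≃ₗ[ℤ_[p]] W.tateModule p,
      Continuous E ∧ Continuous E.symm ∧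
      (∀ σ : absoluteGaloisGroup K, σ • geomSqrt d = geomSqrt d →
        ∀ x : (W.quadraticTwist d).tateModule p, E (σ • x) = σ • E x) ∧
      (∀ σ : absoluteGaloisGroup K, σ • geomSqrt d = -geomSqrt d →
        ∀ x : (W.quadraticTwist d).tateModule p, E (σ • x) = -(σ • E x)) := by
  obtain ⟨f, hf₁, hf₂⟩ := W.exists_addEquiv_geomPoints_quadraticTwist_sign hd
  set s : absoluteGaloisGroup K → ℤˣ := fun σ ↦ if σ • geomSqrt d = geomSqrt d then 1 else -1 with hs
  have hdich : ∀ σ : absoluteGaloisGroup K, ¬ σ • geomSqrt d = geomSqrt d →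
      σ • geomSqrt d = -geomSqrt d := fun σ h ↦
    (map_geomSqrt (absoluteGaloisGroup.toAlgEquiv K σ) d).resolve_left h
  obtain ⟨E, hc, hc', -, hE⟩ := exists_tateModule_equiv_of_addEquiv p
    (MonoidHom.id (absoluteGaloisGroup K)) s f fun σ a ↦ by
      by_cases h : σ • geomSqrt d = geomSqrt d
      · rw [hs]
        simp only [h, if_true, Units.val_one, one_zsmul, MonoidHom.id_apply]
        exact hf₁ σ h a
      · rw [hs]
        simp only [h, if_false, Units.val_neg, Units.val_one, neg_smul, one_zsmul, MonoidHom.id_apply]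
        exact hf₂ σ (hdich σ h) a
  refine ⟨E, hc, hc', fun σ hσ x ↦ ?_, fun σ hσ x ↦ ?_⟩
  · have h := hE σ x
    rw [MonoidHom.id_apply, hs] at h
    simpa [hσ] using h
  · have h := hE σ x
    have hne : ¬ σ • geomSqrt d = geomSqrt d := not_smul_geomSqrt_eq_of_eq_neg hd σ hσ
    rw [MonoidHom.id_apply, hs] at h
    simpa [hne] using h

/-- **`T_p(A) ≃ T_p(E)` for any model `A` of the quadratic twist, `C • A = E^{(d)}`**, continuous, with `E(σx) = ±σE(x)`
according to `σ√d = ±√d`: the change of variables `C` acts on `K̄`-points `Γ_K`-equivariantly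
(`VariableChange.pointEquivBaseChange_map_algEquiv`), so `A(K̄) ≃+ E^{(d)}(K̄) ≃+ E(K̄)` has the signs of the second map.
Silverman, *AEC*, X.5 Cor. 5.4, III.3.1(b), III.§7. [cite: SilvermanAEC2009, X.5 Cor. 5.4] -/
theorem exists_tateModule_equiv_of_smul_eq_quadraticTwist (W A : WeierstrassCurve K) (C : VariableChange K) {d : K}
    (hd : d ≠ 0) (hA : C • A = W.quadraticTwist d) (p : ℕ) [Fact p.Prime] :
    ∃ E : A.tateModule p ≃ₗ[ℤ_[p]] W.tateModule p,
      Continuous E ∧ Continuous E.symm ∧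
      (∀ σ : absoluteGaloisGroup K, σ • geomSqrt d = geomSqrt d → ∀ x : A.tateModule p, E (σ • x) = σ • E x) ∧
      (∀ σ : absoluteGaloisGroup K, σ • geomSqrt d = -geomSqrt d → ∀ x : A.tateModule p, E (σ • x) = -(σ • E x)) := by
  obtain ⟨f, hf₁, hf₂⟩ := W.exists_addEquiv_geomPoints_quadraticTwist_sign hd
  -- `A(K̄) ≃+ (C • A)(K̄) = E^{(d)}(K̄)`, `Γ_K`-equivariantly
  let e₀ : A.geomPoints ≃+ (C • A).geomPoints := VariableChange.pointEquivBaseChange A C (AlgebraicClosure K)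
  let e₁ : (C • A).geomPoints ≃+ (W.quadraticTwist d).geomPoints :=
    Affine.Point.congrEquiv (congrArg (fun Z : WeierstrassCurve K ↦ Z.baseChange (AlgebraicClosure K)) hA)
  have h₀ : ∀ (σ : absoluteGaloisGroup K) (P : A.geomPoints), e₀ (σ • P) = σ • e₀ P := fun σ P ↦
    VariableChange.pointEquivBaseChange_map_algEquiv A C (absoluteGaloisGroup.toAlgEquiv K σ) P
  have h₁ : ∀ (σ : absoluteGaloisGroup K) (P : (C • A).geomPoints), e₁ (σ • P) = σ • e₁ P := fun σ P ↦
    congrEquiv_smul_of_eq hA (absoluteGaloisGroup.toAlgEquiv K σ) P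
  set g : A.geomPoints ≃+ W.geomPoints := (e₀.trans e₁).trans f with hg
  have hg₁ : ∀ σ : absoluteGaloisGroup K, σ • geomSqrt d = geomSqrt d → ∀ P, g (σ • P) = σ • g P := fun σ hσ P ↦ by
    simp only [hg, AddEquiv.trans_apply]
    rw [h₀, h₁, hf₁ σ hσ]
  have hg₂ : ∀ σ : absoluteGaloisGroup K, σ • geomSqrt d = -geomSqrt d → ∀ P, g (σ • P) = -(σ • g P) := fun σ hσ P ↦ by
    simp only [hg, AddEquiv.trans_apply]
    rw [h₀, h₁, hf₂ σ hσ]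
  set s : absoluteGaloisGroup K → ℤˣ := fun σ ↦ if σ • geomSqrt d = geomSqrt d then 1 else -1 with hs
  have hdich : ∀ σ : absoluteGaloisGroup K, ¬ σ • geomSqrt d = geomSqrt d →
      σ • geomSqrt d = -geomSqrt d := fun σ h ↦
    (map_geomSqrt (absoluteGaloisGroup.toAlgEquiv K σ) d).resolve_left h
  obtain ⟨E, hc, hc', -, hE⟩ := exists_tateModule_equiv_of_addEquiv p
    (MonoidHom.id (absoluteGaloisGroup K)) s g fun σ a ↦ by
      by_cases h : σ • geomSqrt d = geomSqrt d
      · rw [hs]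
        simp only [h, if_true, Units.val_one, one_zsmul, MonoidHom.id_apply]
        exact hg₁ σ h a
      · rw [hs]
        simp only [h, if_false, Units.val_neg, Units.val_one, neg_smul, one_zsmul, MonoidHom.id_apply]
        exact hg₂ σ (hdich σ h) a
  refine ⟨E, hc, hc', fun σ hσ x ↦ ?_, fun σ hσ x ↦ ?_⟩
  · have h := hE σ x
    rw [MonoidHom.id_apply, hs] at h
    simpa [hσ] using h
  · have h := hE σ x
    have hne : ¬ σ • geomSqrt d = geomSqrt d := not_smul_geomSqrt_eq_of_eq_neg hd σ hσ
    rw [MonoidHom.id_apply, hs] at h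
    simpa [hne] using h

end Twist

end WeierstrassCurve

end
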